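import Summits.Ventures.HSemireg.WedgeHankelRecurrenceCensusSymbols

/-!
# Venture HSemireg — THE CENSUS BY MINIMAL RECURRENCE (the fibres of the symbol map): for a monic `m` of degree `d` with `2d ≤ N + 1`, **the classes `v` on `[0, N]` of middle rank `d` with
# minimal recurrence `m` are in bijection with the units `a` of `K[X]/(m)` (`deg a < d`, `gcd(m, a) = 1`) via `a ↦ dualSeq m a`**; hence over a field with `s` elements there are
# `φ(m) := #{a : deg a < d, gcd(m, a) = 1}` of them — **`s^d − 1` when `m` is IRREDUCIBLE** (every non-zero residue is a unit); summing `φ(m)` over the monic `m` of degree `d` gives N46's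
# `(s − 1)·s^{2d−1}`

HONEST FRAMING. Part of the Lean index of the computation cell `pub-hsemireg` (seat p10 gen 28, Sunday typer «UNIFORM-IN-n»).
LINEAR ALGEBRA OF HANKEL (catalecticant) MATRICES and of polynomials over a field ONLY: no variety, no cohomology theory, no sheaf, no Ext group and no semiregularity map is constructed
here; nothing here says that HC / HC_CM / HC_AV holds; no Literature fact is declared or used.  Custodian versions as in `WedgeHankelSiegelIdeal` (1/3); the dictionary («classes with
apolar scheme `{m = 0}`»; `φ(m) = |(K[X]/(m))ˣ|`, the Euler function of `K[X]`) is QUOTED, never asserted — `φ(m)` below is a set count, no quotient ring is formed.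

WHAT IS IN THE TREE.  N46 (`WedgeHankelRecurrenceCensusSymbols`, № 328): `reducedSymbols`, `isAffineClass_dualSeq`; N44 (№ 326): `seqOf`, `seqOf_apply_of_lt`; N43 (№ 323) `IsAffineClass`,
`isAffineClass_congr`; N34 (№ 267) `rank_half_eq_and_mem_recSpace_iff_exists_affine`; N32 (№ 263): `dualSeq`, `dualSeq_unique`, `mem_recSpace_dualSeq`, `rank_hankel1_half_dualSeq_of_isCoprime`;
N23 (№ 176) `recSpace_congr`; N34 `rank_hankel1_half_congr`.  Mathlib: `Set.ncard_congr`, `Set.ncard_sdiff_singleton_of_mem`, `Nat.card_coe_set_eq`, `Polynomial.degreeLTEquiv`, `Nat.card_fun` (the count `#K[X]_{<d} = s^d` as in `Literature.NumberTheory.CyclotomicFunctionFields.ncard_degreeLT`, inlined),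
`Irreducible.coprime_iff_not_dvd`, `Polynomial.eq_zero_of_dvd_of_natDegree_lt`.
THIS FILE (namespace `Summit.Ventures.HSemireg.Wedge.HankelOuter` continued; PLAIN on tree files; 1 definition `unitResidues`):
* §570 `unitResidues K m` = `{a | deg a < deg m ∧ IsCoprime m a}` (the units of `K[X]/(m)`, as polynomials of small degree); **`ncard_setOf_rank_eq_and_mem_recSpace`** (`m` monic, `2 deg m ≤ N + 1`:
  `#{v : R^N(v) = deg m ∧ m ∈ Rec^N_{deg m}(v)} = #unitResidues m` — THE FIBRE OF THE SYMBOL MAP OVER `m`).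
* §571 **`unitResidues_eq_of_irreducible`** (`m` irreducible ⇒ `unitResidues m = K[X]_{<deg m} ∖ {0}`), **`ncard_unitResidues_of_irreducible`** (`= s^{deg m} − 1`),
  **`ncard_setOf_rank_eq_and_mem_recSpace_of_irreducible`** (`s^d − 1` classes with an IRREDUCIBLE minimal recurrence `m` of degree `d`, `2d ≤ N + 1`).
Nothing Ext-side.  New names only.
-/

open Module Polynomial
open scoped Matrix Polynomial

namespace Summit.Ventures.HSemireg.Wedge.HankelOuter

open Summit.Ventures.HSemireg.Wedge Summit.Ventures.HSemireg.Wedge.Hankel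

variable (K : Type*) [Field K] {N : ℕ}

/-! ## §570. The fibre of the symbol map over a monic `m`: the units below `m` -/

/-- THE UNITS BELOW `m`: polynomials `a` of degree `< deg m` prime to `m` (representatives of the units of `K[X]/(m)`). [definition of this file] -/
def unitResidues (m : K[X]) : Set K[X] := {a | a ∈ Polynomial.degreeLT K m.natDegree ∧ IsCoprime m a}

/-- membership spelled out. -/
theorem mem_unitResidues_iff {m a : K[X]} : a ∈ unitResidues K m ↔ a ∈ Polynomial.degreeLT K m.natDegree ∧ IsCoprime m a := Iff.rfl

/-- **THE FIBRE OF THE SYMBOL MAP: for `m` monic with `2 deg m ≤ N + 1`, the classes `v` on `[0, N]` with `R^N(v) = deg m` and `m ∈ Rec^N_{deg m}(v)` (i.e. with minimal recurrence `m`)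
are in bijection with `unitResidues m` via `a ↦ (i ↦ dualSeq m a i)`: `#{v | …} = #unitResidues m`.** -/
theorem ncard_setOf_rank_eq_and_mem_recSpace {m : K[X]} (hm : m.Monic) (h2 : m.natDegree + m.natDegree ≤ N + 1) :
    {v : Fin (N + 1) → K | (hankel1 K N (N / 2) (seqOf K v)).rank = m.natDegree ∧ m ∈ recSpace K N (seqOf K v) m.natDegree}.ncard = (unitResidues K m).ncard := by
  symm
  refine Set.ncard_congr (fun a _ => fun i : Fin (N + 1) => dualSeq K m a i) ?_ ?_ ?_
  · rintro a ⟨ha, hcop⟩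
    have hagree : ∀ j ≤ N, seqOf K (fun i : Fin (N + 1) => dualSeq K m a i) j = dualSeq K m a j := fun j hj => by
      rw [seqOf_apply_of_lt K _ (show j < N + 1 by omega)]
    rw [Set.mem_setOf_eq, rank_hankel1_half_congr K hagree, recSpace_congr K hagree]
    exact ⟨rank_hankel1_half_dualSeq_of_isCoprime K hm hcop h2, mem_recSpace_dualSeq K hm a⟩
  · rintro a a' ⟨ha, -⟩ ⟨ha', -⟩ h
    exact dualSeq_unique K (N := N) hm (by omega) ha ha' fun j hj => by
      have := congrFun h ⟨j, by omega⟩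
      exact this
  · rintro v ⟨hq, hmem⟩
    obtain ⟨a, hcop, ha, h⟩ := (rank_half_eq_and_mem_recSpace_iff_exists_affine K (N := N) hm h2 (seqOf K v)).mp ⟨hq, hmem⟩
    refine ⟨a, ⟨ha, hcop⟩, funext fun i => ?_⟩
    rw [← h i (by have := i.2; omega), seqOf_apply_of_lt K v i.2]

/-! ## §571. Irreducible `m`: every non-zero residue is a unit -/

/-- **for `m` irreducible, `unitResidues m = K[X]_{<deg m} ∖ {0}`**: a non-zero polynomial of degree `< deg m` is prime to `m`. -/
theorem unitResidues_eq_of_irreducible {m : K[X]} (hirr : Irreducible m) : unitResidues K m = (Polynomial.degreeLT K m.natDegree : Set K[X]) \ {0} := by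
  ext a
  rw [mem_unitResidues_iff, Set.mem_sdiff, SetLike.mem_coe, Set.mem_singleton_iff]
  constructor
  · rintro ⟨ha, hcop⟩
    refine ⟨ha, fun h0 => ?_⟩
    rw [h0, isCoprime_zero_right] at hcop
    exact hirr.not_isUnit hcop
  · rintro ⟨ha, h0⟩
    refine ⟨ha, (hirr.coprime_iff_not_dvd).mpr fun hdvd => h0 ?_⟩
    exact Polynomial.eq_zero_of_dvd_of_natDegree_lt hdvd ((Polynomial.natDegree_lt_iff_degree_lt h0).mpr (Polynomial.mem_degreeLT.mp ha))

/-- **`#unitResidues m = s^{deg m} − 1` for `m` irreducible.** -/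
theorem ncard_unitResidues_of_irreducible [Finite K] {m : K[X]} (hirr : Irreducible m) : (unitResidues K m).ncard = Nat.card K ^ m.natDegree - 1 := by
  rw [unitResidues_eq_of_irreducible K hirr, Set.ncard_sdiff_singleton_of_mem (show (0 : K[X]) ∈ (Polynomial.degreeLT K m.natDegree : Set K[X]) from Submodule.zero_mem _),
    ← Nat.card_coe_set_eq, SetLike.coe_sort_coe, Nat.card_congr (Polynomial.degreeLTEquiv K m.natDegree).toEquiv, Nat.card_fun, Nat.card_eq_fintype_card (α := Fin m.natDegree),
    Fintype.card_fin]

/-- **`s^d − 1` CLASSES WITH A GIVEN IRREDUCIBLE MINIMAL RECURRENCE: for `m` monic irreducible of degree `d` with `2d ≤ N + 1`, exactly `s^d − 1` classes `v` on `[0, N]` have `R^N(v) = d`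
and `m ∈ Rec^N_d(v)`** (their apolar scheme is the closed point `{m = 0}` of degree `d`). -/
theorem ncard_setOf_rank_eq_and_mem_recSpace_of_irreducible [Finite K] {m : K[X]} (hm : m.Monic) (hirr : Irreducible m) (h2 : m.natDegree + m.natDegree ≤ N + 1) :
    {v : Fin (N + 1) → K | (hankel1 K N (N / 2) (seqOf K v)).rank = m.natDegree ∧ m ∈ recSpace K N (seqOf K v) m.natDegree}.ncard = Nat.card K ^ m.natDegree - 1 := by
  rw [ncard_setOf_rank_eq_and_mem_recSpace K hm h2, ncard_unitResidues_of_irreducible K hirr]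

end Summit.Ventures.HSemireg.Wedge.HankelOuter
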